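import Mathlib
import Summits.ValiantsHypothesis.ValiantsHypothesis.Theorems.ValuativeGCTValuativeFlipFewRowPlethysmCap
import Summits.ValiantsHypothesis.ValiantsHypothesis.Theorems.ValuativeGCTValuativeFlipSemigroupFloor
import Literature.Computability.AlgebraicComplexity.PlethysmLifting

/-!
# Plethysm tables bound seed richness: rich seed weights need many letters

Crux `ValuativeGCT.ValuativeFlip` (stmt-ValiantsHypothesis-12624), wall-breaker axis 14
("plethysm tables for seedRichness, small cases certified").  The stub `stub_seedRichness` (line
`big-cell-semigroup-floor`, dead; re-used as a per-side engine by other axes) asks for `D + 1`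
ALGEBRAICALLY INDEPENDENT highest-weight vectors of one weight `ν` in `ℂ[Δ_m(X₀₀^{m-n} per_n)]` with
`D ≥ n⁴/4`.  The plethysm table caps `D` by the number of letters the weight occupies:

* `finrank_restrictTotalDegree_le_pow` — polynomials of degree `≤ d` in finitely many variables
  `τ` have dimension `≤ (d+1)^{#τ}`;
* `plethysmCoeff_le_pow_card_degIdx` — a weight `ψ` of `GL_ℓ` pins the degree
  (`weightSpace_coordRep_le_restrictTotalDegree`), so `pleth(ψ) ≤ ((-|ψ|)/m + 1)^{M_ℓ}` with
  `M_ℓ = #DegIdx (Fin ℓ) m = C(m+ℓ-1, m)` the number of degree-`m` monomials in `ℓ` letters;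
* `plethysmCoeff_nsmul_le_pow_of_topLetters` — for a weight `χ` of `GL_{m²}` supported on the `ℓ`
  greatest letters (alphabet reduction `plethysmCoeff_extend_eq`): `pleth(k • χ) ≤ (k·|χ| + 1)^{M_ℓ}`
  for every `k`;
* `choose_le_pow_forall_imp_le` — if `C(k+D, D) ≤ (c k + 1)^M` for all `k` then `D ≤ M`
  (polynomial growth degrees);
* `seedRichness_le_card_degIdx` — MAIN: in the coordinate ring of the orbit closure of ANY form
  `f` of degree `m ≥ 1`, `D + 1` algebraically independent highest-weight vectors of a weight
  supported on the `ℓ` greatest letters force `D ≤ M_ℓ = C(m+ℓ-1, m)` (semigroup floor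
  `C(k+D,D) ≤ mult(k • χ)` (landed `semigroupFloor`) `≤ pleth(k • χ)` (BLMW) `≤ (k|χ|+1)^{M_ℓ}`).
  So a seed family of richness `D ≥ n⁴/4` at `m ≤ 1.2 n` cannot live on a weight with `≤ 4` rows
  (`C(m+3, m) = O(m³) < n⁴/4`): rich seeds and the four-row shapes of line `four-row-count` are
  disjoint regimes — the table's row count is the currency common to both.

References: BLMW, SIAM J. Comput. 40 (2011) §4.4 (a weight pins the degree; Prop. 4.4.1);
Kaveh–Khovanskii / Okounkov (growth of graded semigroup algebras) for the floor `C(k+D,D)`.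
-/

set_option linter.dupNamespace false

noncomputable section

namespace Summit.ValiantsHypothesis.ValiantsHypothesis.Theorems.ValuativeFlip

open MvPolynomial
open scoped BigOperators
open Literature.NumberTheory.DiophantineGeometry Literature.Computability.AlgebraicComplexity

/-! ## Counting polynomials of bounded degree -/

/-- Polynomials of total degree `≤ d` in finitely many variables `τ` span a space of dimension at
most `(d+1)^{#τ}` (every exponent is at most `d`). [folklore] -/
theorem finrank_restrictTotalDegree_le_pow (τ : Type*) [Fintype τ] [DecidableEq τ] (d : ℕ) :
    Module.finrank ℂ ↥(restrictTotalDegree τ ℂ d) ≤ (d + 1) ^ Fintype.card τ := by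
  classical
  let b : (τ → Fin (d + 1)) → MvPolynomial τ ℂ := fun g =>
    monomial (Finsupp.equivFunOnFinite.symm fun i => (g i : ℕ)) 1
  have hle : restrictTotalDegree τ ℂ d ≤ Submodule.span ℂ (Set.range b) := by
    intro φ hφ
    rw [mem_restrictTotalDegree] at hφ
    rw [φ.as_sum]
    refine Submodule.sum_mem _ fun s hs => ?_
    have hdi : ∀ i, s i < d + 1 := by
      intro i
      have h1 : s i ≤ s.sum fun _ e => e := by
        by_cases hi : i ∈ s.support
        · exact Finset.single_le_sum (fun _ _ => Nat.zero_le _) hi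
        · rw [Finsupp.notMem_support_iff.mp hi]; exact Nat.zero_le _
      have h2 : (s.sum fun _ e => e) ≤ d := (le_totalDegree hs).trans hφ
      omega
    have : monomial s (coeff s φ) = coeff s φ • b (fun i => ⟨s i, hdi i⟩) := by
      rw [smul_monomial, smul_eq_mul, mul_one]
      congr 1
      ext i
      simp
    rw [this]
    exact Submodule.smul_mem _ _ (Submodule.subset_span (Set.mem_range_self _))
  haveI : Module.Finite ℂ (Submodule.span ℂ (Set.range b)) :=
    Module.Finite.iff_fg.mpr (Submodule.fg_span (Set.finite_range b))
  calc Module.finrank ℂ ↥(restrictTotalDegree τ ℂ d)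
      ≤ Module.finrank ℂ (Submodule.span ℂ (Set.range b)) := Submodule.finrank_mono hle
    _ ≤ Fintype.card (τ → Fin (d + 1)) := finrank_range_le_card b
    _ = (d + 1) ^ Fintype.card τ := by rw [Fintype.card_fun, Fintype.card_fin]

/-! ## The plethysm table is bounded by a monomial count -/

/-- **`pleth(ψ) ≤ ((-|ψ|)/m + 1)^{M}`**, `M = #DegIdx σ m` the number of degree-`m` monomials in the
letters `σ`: highest-weight vectors are torus weight vectors, which have total degree `≤ (-|ψ|)/m`
(a weight pins the degree, `weightSpace_coordRep_le_restrictTotalDegree`). BLMW 2011 §4.4. -/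
theorem plethysmCoeff_le_pow_card_degIdx {σ : Type*} [Fintype σ] [LinearOrder σ] {m : ℕ}
    (hm : m ≠ 0) (ψ : Weight σ) :
    plethysmCoeff ℂ σ m ψ ≤ ((-ψ.size).toNat / m + 1) ^ Fintype.card (DegIdx σ m) := by
  classical
  have hle := (highestWeightSpace_le_weightSpace (coordRep σ ℂ m) ψ).trans
    (weightSpace_coordRep_le_restrictTotalDegree (k := ℂ) hm ψ)
  unfold plethysmCoeff hwMultiplicity
  exact (Submodule.finrank_mono hle).trans (finrank_restrictTotalDegree_le_pow _ _)

/-- A weight of `GL_{m²}` vanishing off the `ℓ` greatest lexicographic letters is the extension by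
zero of its restriction along the top-letters embedding. [folklore] -/
theorem eq_extend_topLetters_of_support {m ℓ : ℕ} (hℓ : ℓ ≤ m * m) (χ : Weight (MatIdx m))
    (hχ : ∀ i, ¬ m * m ≤ (((matIdxEquiv m).symm i : Fin (m * m)) : ℕ) + ℓ → χ i = 0) :
    χ = Function.extend (fun t : Fin ℓ => matIdxEquiv m ⟨m * m - ℓ + t, by omega⟩)
      (fun t : Fin ℓ => χ (matIdxEquiv m ⟨m * m - ℓ + t, by omega⟩)) 0 := by
  funext i
  obtain ⟨j, rfl⟩ : ∃ j : Fin (m * m), matIdxEquiv m j = i :=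
    ⟨(matIdxEquiv m).symm i, (matIdxEquiv m).apply_symm_apply i⟩
  by_cases hj : m * m - ℓ ≤ (j : ℕ)
  · set t : Fin ℓ := ⟨(j : ℕ) - (m * m - ℓ), by omega⟩ with ht
    have hjt : matIdxEquiv m j = (fun t : Fin ℓ => matIdxEquiv m ⟨m * m - ℓ + t, by omega⟩) t := by
      simp only [ht]
      congr 1
      exact Fin.ext (by simp only; omega)
    rw [hjt, (topLetters_strictMono hℓ).injective.extend_apply]
  · push Not at hj
    rw [Function.extend_apply' _ _ _ (fun ⟨t, ht⟩ => by
      have := congrArg (fun x => ((matIdxEquiv m).symm x : ℕ)) ht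
      simp only [OrderIso.symm_apply_apply] at this
      omega)]
    exact hχ _ (by simp only [OrderIso.symm_apply_apply]; omega)

/-- The size of a weight supported on the top letters is the size of its restriction. [folklore] -/
theorem size_restrict_topLetters {m ℓ : ℕ} (hℓ : ℓ ≤ m * m) (χ : Weight (MatIdx m))
    (hχ : ∀ i, ¬ m * m ≤ (((matIdxEquiv m).symm i : Fin (m * m)) : ℕ) + ℓ → χ i = 0) :
    Weight.size (fun t : Fin ℓ => χ (matIdxEquiv m ⟨m * m - ℓ + t, by omega⟩)) = χ.size := by
  classical
  unfold Weight.size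
  symm
  rw [← Finset.sum_subset (Finset.subset_univ (Finset.univ.image
      fun t : Fin ℓ => matIdxEquiv m ⟨m * m - ℓ + t, by omega⟩))
      (fun i _ hi => hχ i fun h => hi ?_)]
  · rw [Finset.sum_image fun s _ t _ hst => (topLetters_strictMono hℓ).injective hst]
  · refine Finset.mem_image.mpr ⟨⟨(((matIdxEquiv m).symm i : Fin (m * m)) : ℕ) - (m * m - ℓ),
      by omega⟩, Finset.mem_univ _, ?_⟩
    conv_rhs => rw [← (matIdxEquiv m).apply_symm_apply i]
    congr 1
    exact Fin.ext (by simp only; omega)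

/-- **Plethysm growth on few letters.** For a weight `χ` of `GL_{m²}` (`m ≠ 0`) supported on the
`ℓ` greatest letters and every `k`: `pleth(k • χ) ≤ (k · (-|χ|).toNat + 1)^{M_ℓ}`,
`M_ℓ = #DegIdx (Fin ℓ) m = C(m+ℓ-1, m)` (alphabet reduction `plethysmCoeff_extend_eq`, then
`plethysmCoeff_le_pow_card_degIdx` in `ℓ` letters). -/
theorem plethysmCoeff_nsmul_le_pow_of_topLetters {m ℓ : ℕ} (hm : m ≠ 0) (hℓ : ℓ ≤ m * m)
    (χ : Weight (MatIdx m))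
    (hχ : ∀ i, ¬ m * m ≤ (((matIdxEquiv m).symm i : Fin (m * m)) : ℕ) + ℓ → χ i = 0) (k : ℕ) :
    plethysmCoeff ℂ (MatIdx m) m (k • χ) ≤
      (k * (-χ.size).toNat + 1) ^ Fintype.card (DegIdx (Fin ℓ) m) := by
  classical
  set χ₀ : Weight (Fin ℓ) := fun t : Fin ℓ => χ (matIdxEquiv m ⟨m * m - ℓ + t, by omega⟩) with hχ₀
  have hkχ : ∀ i, ¬ m * m ≤ (((matIdxEquiv m).symm i : Fin (m * m)) : ℕ) + ℓ → (k • χ) i = 0 := by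
    intro i hi
    simp [hχ i hi]
  have hext : k • χ = Function.extend (fun t : Fin ℓ => matIdxEquiv m ⟨m * m - ℓ + t, by omega⟩)
      (k • χ₀) 0 := by
    rw [hχ₀]
    exact eq_extend_topLetters_of_support hℓ (k • χ) hkχ
  rw [hext, plethysmCoeff_extend_eq (topLetters_strictMono hℓ) (isUpperSet_range_topLetters hℓ)]
  refine (plethysmCoeff_le_pow_card_degIdx hm (k • χ₀)).trans ?_
  apply Nat.pow_le_pow_left
  apply Nat.add_le_add_right
  have hsize : (k • χ₀).size = k * χ.size := by
    rw [← size_restrict_topLetters hℓ χ hχ, ← hχ₀]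
    unfold Weight.size
    simp [Finset.mul_sum]
  rw [hsize]
  refine (Nat.div_le_self _ _).trans ?_
  rw [show -((k : ℤ) * χ.size) = (k : ℤ) * (-χ.size) by ring]
  rcases le_or_gt 0 (-χ.size) with h | h
  · obtain ⟨a, ha⟩ := Int.eq_ofNat_of_zero_le h
    rw [ha, ← Nat.cast_mul, Int.toNat_natCast, Int.toNat_natCast]
  · rw [Int.toNat_eq_zero.mpr (by nlinarith [Int.natCast_nonneg k])]
    exact Nat.zero_le _

/-! ## Growth degrees -/

/-- `C(k+D, D) ≥ (k/D)^D`-type lower bound: `D^D · C(k+D, D) ≥ k^D`. [folklore] -/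
theorem pow_le_mul_choose (k D : ℕ) : k ^ D ≤ D ^ D * (k + D).choose D := by
  rcases Nat.eq_zero_or_pos D with rfl | hD
  · simp
  -- `C(k+D, D) ≥ ((k+D)/D)^D`-free route: `D! C(k+D,D) = (k+1)⋯(k+D) ≥ (k+1)^D ≥ k^D`, `D^D ≥ D!`
  have h1 : (k + D).choose D * D.factorial * k.factorial = (k + D).factorial := by
    have := Nat.choose_mul_factorial_mul_factorial (Nat.le_add_left D k)
    rwa [Nat.add_sub_cancel] at this
  have h2 : k.factorial * (k + 1) ^ D ≤ (k + D).factorial := by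
    have := Nat.factorial_mul_pow_le_factorial (m := k) (n := D)
    exact this
  have h3 : D.factorial ≤ D ^ D := Nat.factorial_le_pow D
  have h4 : k ^ D ≤ (k + 1) ^ D := Nat.pow_le_pow_left (Nat.le_succ k) D
  have hk : 0 < k.factorial := Nat.factorial_pos k
  -- combine: k! k^D ≤ k! (k+1)^D ≤ (k+D)! = C · D! · k!  ⇒  k^D ≤ C · D! ≤ C · D^D
  have h5 : k.factorial * k ^ D ≤ k.factorial * ((k + D).choose D * D.factorial) := by
    calc k.factorial * k ^ D ≤ k.factorial * (k + 1) ^ D := Nat.mul_le_mul_left _ h4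
      _ ≤ (k + D).factorial := h2
      _ = k.factorial * ((k + D).choose D * D.factorial) := by rw [← h1]; ring
  have h6 : k ^ D ≤ (k + D).choose D * D.factorial := Nat.le_of_mul_le_mul_left h5 hk
  calc k ^ D ≤ (k + D).choose D * D.factorial := h6
    _ ≤ (k + D).choose D * D ^ D := Nat.mul_le_mul_left _ h3
    _ = D ^ D * (k + D).choose D := Nat.mul_comm _ _

/-- **Comparison of growth degrees.** If `C(k+D, D) ≤ (c·k + 1)^M` for every `k`, then `D ≤ M`:
the left side grows like `k^D`, the right like `k^M`. [folklore] -/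
theorem choose_le_pow_forall_imp_le {D M c : ℕ} (h : ∀ k : ℕ, (k + D).choose D ≤ (c * k + 1) ^ M) :
    D ≤ M := by
  by_contra hDM
  push Not at hDM
  -- test at `k = K := D^D (c+1)^M + 1`: `k^D ≤ D^D (c k + 1)^M ≤ D^D ((c+1) k)^M`, so `k^(D-M) ≤ D^D (c+1)^M < k`
  set K : ℕ := D ^ D * (c + 1) ^ M + 1 with hK
  have hK1 : 1 ≤ K := Nat.le_add_left 1 _
  have hA : K ^ D ≤ D ^ D * ((c + 1) * K) ^ M := by
    calc K ^ D ≤ D ^ D * (K + D).choose D := pow_le_mul_choose K D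
      _ ≤ D ^ D * (c * K + 1) ^ M := Nat.mul_le_mul_left _ (h K)
      _ ≤ D ^ D * ((c + 1) * K) ^ M := by
          apply Nat.mul_le_mul_left
          apply Nat.pow_le_pow_left
          nlinarith
  have hsplit : K ^ D = K ^ (D - M) * K ^ M := by
    rw [← pow_add, Nat.sub_add_cancel hDM.le]
  rw [hsplit, mul_pow, ← mul_assoc] at hA
  have hKM : 0 < K ^ M := pow_pos (by omega : 0 < K) M
  have hB : K ^ (D - M) ≤ D ^ D * (c + 1) ^ M := Nat.le_of_mul_le_mul_right hA hKM
  have hC : K ≤ K ^ (D - M) := by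
    calc K = K ^ 1 := (pow_one K).symm
      _ ≤ K ^ (D - M) := Nat.pow_le_pow_right hK1 (by omega)
  have : K ≤ D ^ D * (c + 1) ^ M := hC.trans hB
  rw [hK] at this
  omega

/-! ## Main: seed richness is capped by the monomial count of the letters the weight occupies -/

/-- **Rich seed weights need many letters.** Let `f` be a form of degree `m ≥ 1` in the matrix
letters, `χ` a weight of `GL_{m²}` supported on the `ℓ ≤ m²` greatest lexicographic letters, and
`F₀, …, F_D` algebraically independent highest-weight vectors of weight `χ` in `ℂ[Δ_m(f)]`. Then
`D ≤ M_ℓ = #DegIdx (Fin ℓ) m = C(m+ℓ-1, m)`: by the landed semigroup floor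
`C(k+D, D) ≤ mult(k • χ)` (`semigroupFloor`), BLMW `mult ≤ pleth`
(`orbitMultiplicity_le_plethysmCoeff_holds`) and the few-letter plethysm growth bound
`pleth(k • χ) ≤ (k|χ| + 1)^{M_ℓ}` (`plethysmCoeff_nsmul_le_pow_of_topLetters`), for all `k`; then
compare growth degrees (`choose_le_pow_forall_imp_le`). In particular the seed weights of
`stub_seedRichness` (`D ≥ n⁴/4`) occupy `ℓ` letters with `C(m+ℓ-1, m) ≥ n⁴/4` — more than four rows
throughout the head `m ≤ 1.2 n` of line `four-row-count`. -/
theorem seedRichness_le_card_degIdx {m : ℕ} [NeZero m] (f : MvPolynomial (MatIdx m) ℂ)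
    (hf : f.IsHomogeneous m) {ℓ : ℕ} (hℓ : ℓ ≤ m * m) (χ : Weight (MatIdx m))
    (hχ : ∀ i, ¬ m * m ≤ (((matIdxEquiv m).symm i : Fin (m * m)) : ℕ) + ℓ → χ i = 0)
    (D : ℕ) (F : Fin (D + 1) → OrbitCoordRing f m)
    (hF : ∀ i, F i ∈ highestWeightSpace (orbitCoordRep f m) χ) (hind : AlgebraicIndependent ℂ F) :
    D ≤ Fintype.card (DegIdx (Fin ℓ) m) := by
  refine choose_le_pow_forall_imp_le (c := (-χ.size).toNat) fun k => ?_
  calc (k + D).choose D ≤ orbitMultiplicity ℂ f m (k • χ) :=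
        semigroupFloor f (NeZero.ne m) χ D F hF hind k
    _ ≤ plethysmCoeff ℂ (MatIdx m) m (k • χ) :=
        orbitMultiplicity_le_plethysmCoeff_holds f (NeZero.ne m) hf _
    _ ≤ (k * (-χ.size).toNat + 1) ^ Fintype.card (DegIdx (Fin ℓ) m) :=
        plethysmCoeff_nsmul_le_pow_of_topLetters (NeZero.ne m) hℓ χ hχ k
    _ = ((-χ.size).toNat * k + 1) ^ Fintype.card (DegIdx (Fin ℓ) m) := by rw [Nat.mul_comm]

end Summit.ValiantsHypothesis.ValiantsHypothesis.Theorems.ValuativeFlip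

end
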